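import Summits.BirchSwinnertonDyer.BirchSwinnertonDyer.Theorems.EisensteinPrimesBSDpOnCellCAccumHelpersOne
import HarnessLib

/-!
# `p`-adic accumulation of rational divisibilities along a convergent sequence of fibres — part 2: Theorem U₁ `not_dvd_of_uniform_members`; the solving lemma `exists_mul_eq_of_forall_exists_mod`
# (cell `bsd-eis`, crux 4 `BSDpOnCellC` stmt-BirchSwinnertonDyer-19034, line «accum» — the ACCUMULATION LEVER behind the registered stub
# `stub_twoVarRatDivPNew` (crystal v7+); mathematics and Lean text by ideator bsd-idea-12 g15, `HOME pub/ideators/bsd-idea-12/bc/AccumHelpers.lean`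
# sha16 d22ccc6e94281a99 = §0a of `Cruxes/BSDpOnCellC/Lines/accum.lean` v1.5, sorry-free, Mathlib-only; critic idea-crit-14 V99 N2 asked for it to be
# landed as a built module; landed VERBATIM (split into 4 files ≤ 400 l.; part 2/4) by the LEAD cruxlead-19034 g0, `--supports -19034`)

HONEST FRAMING: pure commutative algebra over Mathlib (power series over a complete DVR; Weierstrass division by `X − x`; `π`-adic limits); standard
axioms, no `sorry`, no instance, no notation; nothing about any curve, Selmer group or `L`-function is asserted. It is the INTENDED PROOF MACHINERY of
the stub (member-wise rational divisibilities at the good crystalline members of a Hida branch ACCUMULATE `p`-adically to the `p`-new fibre), not a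
proof of the stub: the member inputs and the fibre control remain. Contents of the whole module (source docstring):

# `p`-adic accumulation of rational divisibilities along a convergent sequence of fibres
(helper module candidate; pure commutative algebra over Mathlib; standard axioms; no `sorry`)

Source: ideator `bsd-idea-12` g15, line «accum» on crux `BSDpOnCellC` (stmt-BirchSwinnertonDyer-19034), where §0a of
`Summits/BirchSwinnertonDyer/BirchSwinnertonDyer/Cruxes/BSDpOnCellC/Lines/accum.lean` (v1.5) carries the same declarations
inside the crux namespace. Critic idea-crit-14 VERDICT #99 N2 asked that this algebra be landed as a built helper module by a
prover/LEAD (`ledger propose … --supports stmt-BirchSwinnertonDyer-19034 --as helper`); this file is the ready source.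

SETTING. `𝒪` a complete DVR (in the application `ℤ_p`), `R := 𝒪⟦X⟧⟦T₂⟧⟦T₁⟧` (as `PowerSeries (PowerSeries (PowerSeries 𝒪))`,
innermost variable `X`), fibre ring `S := 𝒪⟦T₂⟧⟦T₁⟧`, `[X − y] := C (C (X − C y))`.

CONTENTS.
* `co`, `co_C_C_mul`, `eq_zero_of_co_eq_zero` — double coefficients.
* Theorem A `exists_eq_C_C_pow_mul_unit_of_coeff_adic_limit` — closedness of `π^ℕ·(units)` in `S` under coefficientwise
  `π`-adic convergence uniform in the index; `finite_pow_dvd_of_dvr`.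
* Evaluation calculus `evAt` / `EvAt` at a point of the maximal ideal = Weierstrass division by the degree-one distinguished
  polynomial `X − x` (`Polynomial.IsDistinguishedAt.algEquivQuotient`, `Polynomial.quotientSpanXSubCAlgEquiv`): `evAt_C`,
  `evAt_X`, `evAt_eq_zero_iff` (kernel `= (X − C x)`), `sub_dvd_evAt_sub_evAt`, `EvAt_C_C`, `co_EvAt`,
  `C_C_dvd_of_EvAt_eq_zero`, `EvAt_lift`.
* Theorem U₁ `not_dvd_of_uniform_members` — uniform member constant and `[X − x_∞] ∤ L` ⟹ `[X − x_∞] ∤ F`.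
* Solving lemma `exists_mul_eq_of_forall_exists_mod` — `A·Z ≡ B (mod π^m)` solvable in `S` for all `m` ⟹ `A·Z = B` solvable
  (content decomposition; a unit-content series is a non-zero-divisor modulo every `π^m` because `(𝒪/π)⟦T₂⟧⟦T₁⟧` is a domain —
  `C_C_dvd_of_dvd_mul`, `C_C_pow_dvd_of_dvd_mul`; Cauchy + `IsPrecomplete`).
* Theorem U₂ `dvd_limit_of_uniform_members`, `uniform_variant_holds` — the uniform-constant accumulation lemma.
* Content decomposition `exists_eq_C_C_pow_mul_not_dvd`; Theorem P `dvd_limit_of_members` — the accumulation lemma with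
  VARYING member constants: `∀ k, p^{c_k}·L ∈ (F, [X − x_k])`, `x_k → x_∞` `p`-adically, `[X − x_∞] ∤ F` ⟹
  `∃ a, p^a·L ∈ (F, [X − x_∞])` (no unique factorisation used).
* Consumer schema `C_C_pow_mul_limit_mem_of_members` / `C_C_pow_mul_limit_mem_of_uniform_members` — an ideal `I ∋ p^m·F(x_∞)`
  receives `p^{c'}·L(x_∞)`.

[cite: BuyukbodukLei2020, App. A Prop. 25 (arXiv:2008.08411 p. 51: the exact, Zariski-infinite, uniform-constant, upward sibling
«a divisibility criterion in regular rings»)]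
-/

set_option autoImplicit false
set_option linter.dupNamespace false

noncomputable section

namespace Summit.BirchSwinnertonDyer.BirchSwinnertonDyer.Theorems.AccumHelpers

open PowerSeries

/-! ### Theorem U₁: uniform member constants + nondegenerate analytic limit fibre ⟹ nondegenerate
algebraic limit fibre (the torsion OUTPUT of `AccumulationLemma₂U`), PROVED. -/

section Uniform

open Filter

/-- `p`-adic convergence in `ℤ_[p]` gives divisibility of differences by high powers of `p`. -/
lemma eventually_pow_dvd_sub {p : ℕ} [Fact p.Prime] (x : ℕ → ℤ_[p]) (xlim : ℤ_[p])
    (hx : Tendsto x atTop (nhds xlim)) (m : ℕ) :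
    ∀ᶠ k in atTop, (p : ℤ_[p]) ^ m ∣ x k - xlim := by
  have hp0 : (0 : ℝ) < (p : ℝ) := by exact_mod_cast (Fact.out : p.Prime).pos
  have hε : (0 : ℝ) < (p : ℝ) ^ (-(m : ℤ)) := zpow_pos hp0 _
  have := (Metric.tendsto_atTop.mp hx) _ hε
  obtain ⟨N, hN⟩ := this
  filter_upwards [eventually_ge_atTop N] with k hk
  have h1 : ‖x k - xlim‖ ≤ (p : ℝ) ^ (-(m : ℤ)) := by
    have := hN k hk
    rw [dist_eq_norm] at this
    exact this.le
  rw [PadicInt.norm_le_pow_iff_mem_span_pow] at h1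
  exact Ideal.mem_span_singleton.mp h1

/-- Helper `not_dvd_of_uniform_members` of the accumulation lemma (line «accum» §0a; statement as displayed; pure commutative algebra). [folklore] -/
theorem not_dvd_of_uniform_members {p : ℕ} [Fact p.Prime]
    (𝒪 : Type*) [CommRing 𝒪] [IsDomain 𝒪] [IsDiscreteValuationRing 𝒪] [Algebra ℤ_[p] 𝒪]
    [IsAdicComplete (IsLocalRing.maximalIdeal 𝒪) 𝒪] (hp : Irreducible ((p : ℕ) : 𝒪))
    (F L : PowerSeries (PowerSeries (PowerSeries 𝒪))) (x : ℕ → ℤ_[p]) (xlim : ℤ_[p]) (c : ℕ)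
    (hxk : ∀ k, ‖x k‖ < 1) (hxlim : ‖xlim‖ < 1)
    (hconv : Tendsto x atTop (nhds xlim))
    (hmem : ∀ k, ∃ G U : PowerSeries (PowerSeries (PowerSeries 𝒪)),
      PowerSeries.C (PowerSeries.C (PowerSeries.C (((p : ℕ) : 𝒪) ^ c))) * L =
        F * G + PowerSeries.C (PowerSeries.C (PowerSeries.X - PowerSeries.C (algebraMap ℤ_[p] 𝒪 (x k)))) * U)
    (hL : ¬ (PowerSeries.C (PowerSeries.C (PowerSeries.X - PowerSeries.C (algebraMap ℤ_[p] 𝒪 xlim))) ∣ L)) :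
    ¬ (PowerSeries.C (PowerSeries.C (PowerSeries.X - PowerSeries.C (algebraMap ℤ_[p] 𝒪 xlim))) ∣ F) := by
  classical
  -- the points lie in the maximal ideal
  have hpmem : ((p : ℕ) : 𝒪) ∈ IsLocalRing.maximalIdeal 𝒪 :=
    (IsLocalRing.mem_maximalIdeal _).mpr hp.not_isUnit
  have hpt : ∀ z : ℤ_[p], ‖z‖ < 1 → algebraMap ℤ_[p] 𝒪 z ∈ IsLocalRing.maximalIdeal 𝒪 := by
    intro z hz
    obtain ⟨y, hy⟩ := (PadicInt.norm_lt_one_iff_dvd z).mp hz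
    rw [hy, map_mul, map_natCast]
    exact Ideal.mul_mem_right _ _ hpmem
  set xs : ℕ → 𝒪 := fun k => algebraMap ℤ_[p] 𝒪 (x k) with hxs
  set xsl : 𝒪 := algebraMap ℤ_[p] 𝒪 xlim with hxsl
  have hxs_mem : ∀ k, xs k ∈ IsLocalRing.maximalIdeal 𝒪 := fun k => hpt _ (hxk k)
  have hxsl_mem : xsl ∈ IsLocalRing.maximalIdeal 𝒪 := hpt _ hxlim
  -- divisibility of `xs k - xsl` by powers of `p`
  have hdiff : ∀ m : ℕ, ∀ᶠ k in atTop, ((p : ℕ) : 𝒪) ^ m ∣ xs k - xsl := by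
    intro m
    filter_upwards [eventually_pow_dvd_sub x xlim hconv m] with k hk
    have := map_dvd (algebraMap ℤ_[p] 𝒪) hk
    simpa [map_pow, map_natCast, map_sub] using this
  intro hF
  obtain ⟨F₁, hF₁⟩ := hF
  have hp0 : ((p : ℕ) : 𝒪) ≠ 0 := hp.ne_zero
  -- Claim: every coefficient of `Ev_∞ L` is divisible by every power of `p`.
  have hall : ∀ i j (n : ℕ), ((p : ℕ) : 𝒪) ^ n ∣ co i j (EvAt xsl hxsl_mem L) := by
    intro i j n
    obtain ⟨k, hk⟩ := (hdiff (c + n)).exists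
    obtain ⟨G, U, hGU⟩ := hmem k
    -- apply `Ev_k` to the member identity
    have e1 : EvAt (xs k) (hxs_mem k) (PowerSeries.C (PowerSeries.C (PowerSeries.C (((p : ℕ) : 𝒪) ^ c)))) =
        PowerSeries.C (PowerSeries.C (((p : ℕ) : 𝒪) ^ c)) := by
      rw [EvAt_C_C, evAt_C]
    have e2 : EvAt (xs k) (hxs_mem k) (PowerSeries.C (PowerSeries.C (PowerSeries.X - PowerSeries.C xsl))) =
        PowerSeries.C (PowerSeries.C (xs k - xsl)) := by
      rw [EvAt_C_C, map_sub, evAt_X, evAt_C]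
    have e3 : EvAt (xs k) (hxs_mem k)
        (PowerSeries.C (PowerSeries.C (PowerSeries.X - PowerSeries.C (algebraMap ℤ_[p] 𝒪 (x k))))) = 0 := by
      rw [EvAt_C_C, map_sub, evAt_X, evAt_C,
        show xs k - algebraMap ℤ_[p] 𝒪 (x k) = 0 from sub_self _, map_zero, map_zero]
    rw [hF₁] at hGU
    have hEv := congrArg (EvAt (xs k) (hxs_mem k)) hGU
    simp only [map_mul, map_add, e1, e2, e3, zero_mul, add_zero] at hEv
    -- coefficient `(i,j)`: `p^c * co (Ev_k L) = (xs k - xsl) * co (...)`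
    have hco : ((p : ℕ) : 𝒪) ^ c * co i j (EvAt (xs k) (hxs_mem k) L) =
        (xs k - xsl) * co i j (EvAt (xs k) (hxs_mem k) F₁ * EvAt (xs k) (hxs_mem k) G) := by
      have := congrArg (co i j) hEv
      rwa [co_C_C_mul, mul_assoc, co_C_C_mul] at this
    -- so `p^(c+n) ∣ p^c * co i j (Ev_k L)`
    have h1 : ((p : ℕ) : 𝒪) ^ (c + n) ∣ ((p : ℕ) : 𝒪) ^ c * co i j (EvAt (xs k) (hxs_mem k) L) := by
      rw [hco]; exact dvd_mul_of_dvd_left hk _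
    have h2 : ((p : ℕ) : 𝒪) ^ n ∣ co i j (EvAt (xs k) (hxs_mem k) L) := by
      rw [pow_add] at h1
      exact (mul_dvd_mul_iff_left (pow_ne_zero _ hp0)).mp h1
    -- compare with the limit fibre
    have h3 : ((p : ℕ) : 𝒪) ^ n ∣
        co i j (EvAt (xs k) (hxs_mem k) L) - co i j (EvAt xsl hxsl_mem L) := by
      rw [co_EvAt, co_EvAt]
      exact ((pow_dvd_pow _ (Nat.le_add_left n c)).trans hk).trans
        (sub_dvd_evAt_sub_evAt _ _ (hxs_mem k) hxsl_mem _)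
    have := dvd_sub h2 h3
    simpa using this
  -- hence `Ev_∞ L = 0`
  have hzero : EvAt xsl hxsl_mem L = 0 := by
    apply eq_zero_of_co_eq_zero
    intro i j
    by_contra hne
    obtain ⟨n, hn⟩ := finite_pow_dvd_of_dvr ((p : ℕ) : 𝒪) hp _ hne
    exact hn (hall i j n)
  exact hL (C_C_dvd_of_EvAt_eq_zero xsl hxsl_mem L hzero)

end Uniform

/-! ### Solving `A·Z = B` from solvability modulo every `π^m` (no UFD, no compactness) -/

section Solve

variable {𝒪 : Type*} [CommRing 𝒪]

/-- Helper `C_C_dvd_iff_forall_co_dvd` of the accumulation lemma (line «accum» §0a; statement as displayed; pure commutative algebra). [folklore] -/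
lemma C_C_dvd_iff_forall_co_dvd (a : 𝒪) (H : PowerSeries (PowerSeries 𝒪)) :
    PowerSeries.C (PowerSeries.C a) ∣ H ↔ ∀ i j, a ∣ co i j H := by
  constructor
  · rintro ⟨W, rfl⟩ i j
    exact ⟨co i j W, by rw [co_C_C_mul]⟩
  · intro h
    choose q hq using h
    refine ⟨PowerSeries.mk fun i => PowerSeries.mk fun j => q i j, ?_⟩
    refine PowerSeries.ext fun i => ?_
    rw [PowerSeries.coeff_C_mul]
    refine PowerSeries.ext fun j => ?_
    rw [PowerSeries.coeff_C_mul]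
    simp only [PowerSeries.coeff_mk]
    exact hq i j

/-- Helper `C_C_pow` of the accumulation lemma (line «accum» §0a; statement as displayed; pure commutative algebra). [folklore] -/
lemma C_C_pow (a : 𝒪) (m : ℕ) :
    (PowerSeries.C (PowerSeries.C (a ^ m)) : PowerSeries (PowerSeries 𝒪)) =
      PowerSeries.C (PowerSeries.C a) ^ m := by
  rw [map_pow, map_pow]

/-- `C (C π)` is prime in `𝒪⟦T₂⟧⟦T₁⟧` when `π` is prime in `𝒪`: the form we need. -/
lemma C_C_dvd_of_dvd_mul [IsDomain 𝒪] (π : 𝒪) (hπ : Prime π) (F W : PowerSeries (PowerSeries 𝒪))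
    (h : PowerSeries.C (PowerSeries.C π) ∣ F * W) (hF : ¬ PowerSeries.C (PowerSeries.C π) ∣ F) :
    PowerSeries.C (PowerSeries.C π) ∣ W := by
  classical
  haveI : (Ideal.span ({π} : Set 𝒪)).IsPrime := (Ideal.span_singleton_prime hπ.ne_zero).mpr hπ
  haveI : IsDomain (𝒪 ⧸ Ideal.span ({π} : Set 𝒪)) :=
    (Ideal.Quotient.isDomain_iff_prime _).mpr inferInstance
  let φ : PowerSeries (PowerSeries 𝒪) →+* PowerSeries (PowerSeries (𝒪 ⧸ Ideal.span ({π} : Set 𝒪))) :=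
    PowerSeries.map (PowerSeries.map (Ideal.Quotient.mk (Ideal.span ({π} : Set 𝒪))))
  have hker : ∀ H : PowerSeries (PowerSeries 𝒪), φ H = 0 ↔ PowerSeries.C (PowerSeries.C π) ∣ H := by
    intro H
    rw [C_C_dvd_iff_forall_co_dvd]
    constructor
    · intro h0 i j
      have := congrArg (fun G => PowerSeries.coeff j (PowerSeries.coeff i G)) h0
      simp only [φ, PowerSeries.coeff_map, map_zero, Ideal.Quotient.eq_zero_iff_mem,
        Ideal.mem_span_singleton] at this
      exact this
    · intro h
      refine PowerSeries.ext fun i => PowerSeries.ext fun j => ?_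
      simp only [φ, PowerSeries.coeff_map, map_zero, Ideal.Quotient.eq_zero_iff_mem,
        Ideal.mem_span_singleton]
      exact h i j
  have hmul : φ F * φ W = 0 := by rw [← map_mul, (hker _).mpr h]
  rcases mul_eq_zero.mp hmul with h1 | h2
  · exact absurd ((hker F).mp h1) hF
  · exact (hker W).mp h2

/-- Helper `C_C_pow_dvd_of_dvd_mul` of the accumulation lemma (line «accum» §0a; statement as displayed; pure commutative algebra). [folklore] -/
lemma C_C_pow_dvd_of_dvd_mul [IsDomain 𝒪] (π : 𝒪) (hπ : Prime π) (F : PowerSeries (PowerSeries 𝒪))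
    (hF : ¬ PowerSeries.C (PowerSeries.C π) ∣ F) :
    ∀ (m : ℕ) (W : PowerSeries (PowerSeries 𝒪)),
      PowerSeries.C (PowerSeries.C (π ^ m)) ∣ F * W → PowerSeries.C (PowerSeries.C (π ^ m)) ∣ W := by
  intro m
  induction m with
  | zero => intro W _; simp
  | succ m ih =>
    intro W h
    have h1 : PowerSeries.C (PowerSeries.C π) ∣ F * W := by
      refine (dvd_trans ?_ h)
      rw [C_C_pow]
      exact dvd_pow_self _ (Nat.succ_ne_zero m)
    obtain ⟨W₁, rfl⟩ := C_C_dvd_of_dvd_mul π hπ F W h1 hF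
    obtain ⟨V, hV⟩ := h
    have hne : (PowerSeries.C (PowerSeries.C π) : PowerSeries (PowerSeries 𝒪)) ≠ 0 := by
      intro h0
      have := congrArg (fun G => co 0 0 G) h0
      simp only [co, PowerSeries.coeff_zero_eq_constantCoeff_apply, PowerSeries.constantCoeff_C,
        map_zero] at this
      exact hπ.ne_zero this
    have h2 : F * W₁ = PowerSeries.C (PowerSeries.C (π ^ m)) * V := by
      apply mul_left_cancel₀ hne
      rw [← mul_assoc, mul_comm (PowerSeries.C (PowerSeries.C π)) F, mul_assoc, hV, pow_succ,
        map_mul, map_mul]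
      ring
    have h3 := ih W₁ ⟨V, h2⟩
    rw [pow_succ, map_mul, map_mul, mul_comm]
    exact mul_dvd_mul_left _ h3

/-- **Solving lemma.** `𝒪` a complete DVR with uniformiser `π`: if `A·Z ≡ B (mod π^m)` is solvable in
`𝒪⟦T₂⟧⟦T₁⟧` for every `m`, then `A·Z = B` is solvable. (Content decomposition `A = π^b·A'`, `A'` a
non-zero-divisor modulo every `π^m`, uniqueness makes the approximate solutions Cauchy; completeness.) -/
theorem exists_mul_eq_of_forall_exists_mod [IsDomain 𝒪] [IsDiscreteValuationRing 𝒪]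
    [IsAdicComplete (IsLocalRing.maximalIdeal 𝒪) 𝒪] (π : 𝒪) (hπ : Irreducible π)
    (A B : PowerSeries (PowerSeries 𝒪))
    (hsol : ∀ m : ℕ, ∃ Z : PowerSeries (PowerSeries 𝒪),
      PowerSeries.C (PowerSeries.C (π ^ m)) ∣ A * Z - B) :
    ∃ Z : PowerSeries (PowerSeries 𝒪), A * Z = B := by
  classical
  have hprime : Prime π := hπ.prime
  have hmax : IsLocalRing.maximalIdeal 𝒪 = Ideal.span {π} :=
    (IsDiscreteValuationRing.irreducible_iff_uniformizer π).mp hπ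
  -- coefficients divisible by every power of π vanish
  have hzero : ∀ c : 𝒪, (∀ n : ℕ, π ^ n ∣ c) → c = 0 := by
    intro c hc
    by_contra hne
    obtain ⟨n, hn⟩ := finite_pow_dvd_of_dvr π hπ c hne
    exact hn (hc n)
  by_cases hA : A = 0
  · subst hA
    refine ⟨0, ?_⟩
    have hB : ∀ i j (n : ℕ), π ^ n ∣ co i j B := by
      intro i j n
      obtain ⟨Z, hZ⟩ := hsol n
      rw [zero_mul, zero_sub, dvd_neg] at hZ
      exact (C_C_dvd_iff_forall_co_dvd _ _).mp hZ i j
    rw [mul_zero]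
    exact (eq_zero_of_co_eq_zero B fun i j => hzero _ (hB i j)).symm
  -- content decomposition of A
  obtain ⟨i₀, j₀, hd⟩ : ∃ i j, co i j A ≠ 0 := by
    by_contra hall
    push Not at hall
    exact hA (eq_zero_of_co_eq_zero A hall)
  have hex : ∃ n : ℕ, ∃ i j, ¬ π ^ (n + 1) ∣ co i j A := by
    obtain ⟨N, hN⟩ := finite_pow_dvd_of_dvr π hπ _ hd
    rcases N with _ | n
    · exact absurd (by simp) hN
    · exact ⟨n, i₀, j₀, hN⟩
  let b := Nat.find hex
  obtain ⟨i₁, j₁, hb⟩ : ∃ i j, ¬ π ^ (b + 1) ∣ co i j A := Nat.find_spec hex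
  have hball : ∀ i j, π ^ b ∣ co i j A := by
    intro i j
    rcases Nat.eq_zero_or_pos b with h0 | hpos
    · rw [h0, pow_zero]; exact one_dvd _
    · have hmin := Nat.find_min hex (m := b - 1) (by omega)
      push Not at hmin
      have := hmin i j
      rwa [Nat.sub_add_cancel hpos] at this
  obtain ⟨A', hA'⟩ := (C_C_dvd_iff_forall_co_dvd (π ^ b) A).mpr hball
  have hA'nd : ¬ PowerSeries.C (PowerSeries.C π) ∣ A' := by
    intro h
    apply hb
    have h' := (C_C_dvd_iff_forall_co_dvd π A').mp h i₁ j₁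
    rw [hA', co_C_C_mul, pow_succ]
    exact mul_dvd_mul_left _ h'
  have hCne : ∀ m : ℕ, (PowerSeries.C (PowerSeries.C (π ^ m)) : PowerSeries (PowerSeries 𝒪)) ≠ 0 := by
    intro m h0
    have := congrArg (fun G => co 0 0 G) h0
    simp only [co, PowerSeries.coeff_zero_eq_constantCoeff_apply, PowerSeries.constantCoeff_C,
      map_zero] at this
    exact pow_ne_zero _ hπ.ne_zero this
  -- B is divisible by π^b
  obtain ⟨B', hB'⟩ : PowerSeries.C (PowerSeries.C (π ^ b)) ∣ B := by
    obtain ⟨Z, hZ⟩ := hsol b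
    have h1 : PowerSeries.C (PowerSeries.C (π ^ b)) ∣ A * Z := by
      rw [hA', mul_assoc]; exact dvd_mul_right _ _
    have := dvd_sub h1 hZ
    simpa using this
  -- reduced approximate solutions
  have hsol' : ∀ m : ℕ, ∃ Z : PowerSeries (PowerSeries 𝒪),
      PowerSeries.C (PowerSeries.C (π ^ m)) ∣ A' * Z - B' := by
    intro m
    obtain ⟨Z, hZ⟩ := hsol (b + m)
    refine ⟨Z, ?_⟩
    rw [hA', hB', mul_assoc, ← mul_sub, pow_add, map_mul, map_mul] at hZ
    exact (mul_dvd_mul_iff_left (hCne b)).mp hZ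
  choose Z hZ using hsol'
  -- Cauchy property
  have hcau : ∀ m n, m ≤ n → PowerSeries.C (PowerSeries.C (π ^ m)) ∣ Z m - Z n := by
    intro m n hmn
    apply C_C_pow_dvd_of_dvd_mul π hprime A' hA'nd m
    have h1 : PowerSeries.C (PowerSeries.C (π ^ m)) ∣ A' * Z n - B' :=
      (dvd_trans (by rw [C_C_pow, C_C_pow]; exact pow_dvd_pow _ hmn) (hZ n))
    have := dvd_sub (hZ m) h1
    rw [mul_sub]
    simpa using this
  -- coefficientwise limits
  have hlim : ∀ i j, ∃ z : 𝒪, ∀ n, π ^ n ∣ co i j (Z n) - z := by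
    intro i j
    have hf : ∀ {m n}, m ≤ n → co i j (Z m) ≡ co i j (Z n)
        [SMOD (IsLocalRing.maximalIdeal 𝒪 ^ m • ⊤ : Submodule 𝒪 𝒪)] := by
      intro m n hmn
      rw [SModEq.sub_mem, hmax, Ideal.span_singleton_pow, smul_eq_mul, Ideal.mul_top,
        Ideal.mem_span_singleton]
      have := (C_C_dvd_iff_forall_co_dvd _ _).mp (hcau m n hmn) i j
      simpa [co, map_sub] using this
    obtain ⟨z, hz⟩ := IsPrecomplete.prec' (fun m => co i j (Z m)) hf
    refine ⟨z, fun n => ?_⟩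
    have := hz n
    rwa [SModEq.sub_mem, hmax, Ideal.span_singleton_pow, smul_eq_mul, Ideal.mul_top,
      Ideal.mem_span_singleton] at this
  choose z hz using hlim
  set Zinf : PowerSeries (PowerSeries 𝒪) := PowerSeries.mk fun i => PowerSeries.mk fun j => z i j
  have hco : ∀ i j, co i j Zinf = z i j := by
    intro i j; simp only [Zinf, co, PowerSeries.coeff_mk]
  have happrox : ∀ n, PowerSeries.C (PowerSeries.C (π ^ n)) ∣ Z n - Zinf := by
    intro n
    rw [C_C_dvd_iff_forall_co_dvd]
    intro i j
    have := hz i j n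
    simpa [co, map_sub, hco, Zinf] using this
  have hfinal : ∀ n, PowerSeries.C (PowerSeries.C (π ^ n)) ∣ A' * Zinf - B' := by
    intro n
    have h1 : PowerSeries.C (PowerSeries.C (π ^ n)) ∣ A' * (Z n - Zinf) :=
      dvd_mul_of_dvd_right (happrox n) _
    have := dvd_sub (hZ n) h1
    rw [mul_sub] at this
    simpa using this
  have hEq : A' * Zinf - B' = 0 := by
    apply eq_zero_of_co_eq_zero
    intro i j
    apply hzero
    intro n
    exact (C_C_dvd_iff_forall_co_dvd _ _).mp (hfinal n) i j
  refine ⟨Zinf, ?_⟩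
  rw [hA', hB', mul_assoc, sub_eq_zero.mp hEq]

end Solve

end Summit.BirchSwinnertonDyer.BirchSwinnertonDyer.Theorems.AccumHelpers

end
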